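import Summits.Parity.GeneralizedHardyLittlewood.Theorems.BeyondDiagonalBeatsQuarter.OffDiagBlockSwitch
import Summits.Parity.GeneralizedHardyLittlewood.Theorems.BeyondDiagonalBeatsQuarter.OffDiagDualSwitchFormRight
import HarnessLib

/-!
# Route `PrimeLevelFamEdge`, crux K_B (stmt-Parity-20343), line `diagonal_kernel_split` rev 4, plan Ω,
# KEYS-NEXT S3, part 3 (OMEGA-BLUEPRINT L6′, the `β`-UNIT stratum) — **the block switch when only the SECOND
# frequency parameter `b = m/d₂` is a unit mod `C = q(r+1)`: the `|h₁| ≤ H`-truncated dual series in `(h₂, s)`-form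
# (outer dual modulus `h₂` a COMPLETE series, the truncation riding on the switched variable `h₁ = (ba + Cs)/h₂`),
# its summabilities, and the block exchange with a series outer variable**

`OffDiagBlockSwitch` (p648494) switches the truncated dual series of `offDiagCore` when `a = l/d₁` is a unit mod `C`
(outer variable `h₁`, a finite range). When `(l/d₁, r+1) > 1` but `(m/d₂, r+1) = 1` the symmetry
`OffDiag.dualCount_swap` (p642224) puts the unit on the second frequency (`OffDiagDualSwitchFormRight`, p642927); the
truncation `|h₁| ≤ H` of the core then sits on the SWITCHED variable, so the outer sum over the unit modulus `h₂` stays a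
series. This file is that mirror image, in the shapes `OffDiagCoreSplit` (step (iii), β-stratum) consumes:

* §1 `tsum_fiber_dual_eq_switch_right`, `tsum_dual_eq_tsum_switch_weight_right`, `summable_switch_outer_right`,
  `summable_switch_of_summable_fiber_right` — general weight `F(h₁,h₂)`, unit on `b`: fiber `h₂` by fiber,
  `Σ'_{h₁} F(h₁,h₂)·N_C(a,b;h₁,h₂) = 𝟙[h₂ unit]·Σ'_{s} 𝟙[h₂ ∣ ba + Cs]·F((ba + Cs)/h₂, h₂)`;
* §2 `tsum_fiber_trunc_switch_right_fourier2`, **`tsum_trunc_dual_eq_tsum_switch_right_fourier2`**,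
  `summable_trunc_switch_outer_right_fourier2`, `summable_trunc_switch_right_fourier2` — the `offDiagCore` summand:
  `Σ_{h∈ℤ²} 𝟙[|h₁| ≤ H]·Φ̂(h/C)·N = Σ'_{h₂} 𝟙[h₂ unit]·Σ'_{s} 𝟙[h₂ ∣ ba + Cs]·𝟙[|(ba + Cs)/h₂| ≤ H]·Φ̂(s/h₂ + ba/(h₂C), h₂/C)`
  with the outer `h₂`-family and every inner `s`-family summable (from `OffDiag.summable_dual`, no decay estimate);
* §3 **`sum_levels_tsum_tsum_switch_eq`** — the block exchange with a SERIES outer variable: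
  `Σ_{q∈G} Σ'_{h} 𝟙[U q h]·Σ'_{s} 𝟙[D q h s]·g = Σ'_{h} Σ'_{s} Σ_{q∈G} 𝟙[U]𝟙[D]·g` (two `Summable.tsum_finsetSum`,
  outer summability as hypothesis — §2 supplies it); the inner level sums are then `levelAPSum`s to modulus `|h₂|`
  by `OffDiagBlockStrata` with `(a, b)` read as `(b, a)`.

Decidability of `h₂ unit mod C` is a hypothesis of every statement displaying it (per level `NeZero` gives the finite
instance, under `Σ_q` only the classical one). Bookkeeping over landed identities; theorems only; standard axioms.
Helper toward `stub_offDiagBelowSlack_io`; closes nothing.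
«The programme SEARCHES and TYPES; no claim about Landau–Siegel zeros, Theorems 1–2 of arXiv:2211.02515 or
a repaired Margin232 until a kernel theorem says so.»
-/

noncomputable section

open Finset
open scoped Real FourierTransform

namespace Summit.Parity.GeneralizedHardyLittlewood.Theorems.BeyondDiagonalBeatsQuarter.OffDiag

open Literature.NumberTheory.Sieve.FriedlanderIwaniecPrimes (fourier2)

variable {C : ℕ} [NeZero C]

/-! ### §1. The right switch for a general weight -/

/-- The dual family with the roles of the two frequencies exchanged (`OffDiag.dualCount_swap`), pointwise. [folklore] -/
theorem dual_weight_swap (a b : ℕ) (F : ℤ → ℤ → ℂ) (h₁ h₂ : ℤ) :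
    F h₁ h₂ * (dualCount C (a : ZMod C) (b : ZMod C) (h₁ : ZMod C) (h₂ : ZMod C) : ℂ) =
      (fun k₂ k₁ ↦ F k₁ k₂) h₂ h₁ *
        (dualCount C (b : ZMod C) (a : ZMod C) (h₂ : ZMod C) (h₁ : ZMod C) : ℂ) := by
  rw [dualCount_swap]

/-- **One fiber of the dual series in right-switched form (general weight).** For `C ≥ 2`, `b` a unit mod `C`, any
`a`, any weight `F : ℤ → ℤ → ℂ` and any `h₂`:
`Σ'_{h₁} F(h₁,h₂)·N_C(a,b;h₁,h₂) = 𝟙[h₂ unit mod C]·Σ'_{s} 𝟙[h₂ ∣ ba + Cs]·F((ba + Cs)/h₂, h₂)`.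
[cite: KowalskiMichelVanderKam2000, Lemma 3.3 p. 9 — derivation] -/
theorem tsum_fiber_dual_eq_switch_right [∀ h₂ : ℤ, Decidable (IsUnit ((h₂ : ℤ) : ZMod C))] (hC : 2 ≤ C)
    (a : ℕ) {b : ℕ} (hb : IsUnit ((b : ℕ) : ZMod C)) (F : ℤ → ℤ → ℂ) (h₂ : ℤ) :
    ∑' h₁ : ℤ, F h₁ h₂ * (dualCount C (a : ZMod C) (b : ZMod C) (h₁ : ZMod C) (h₂ : ZMod C) : ℂ) =
      if IsUnit ((h₂ : ℤ) : ZMod C) then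
        ∑' s : ℤ, (if h₂ ∣ (b : ℤ) * a + (C : ℤ) * s then F (((b : ℤ) * a + (C : ℤ) * s) / h₂) h₂ else 0)
      else 0 := by
  simp_rw [dual_weight_swap a b F _ h₂]
  exact tsum_fiber_dual_eq_switch hC hb a (fun k₂ k₁ ↦ F k₁ k₂) h₂

/-- The swapped dual family is summable when the dual family is. [folklore] -/
theorem summable_dual_swap (a b : ℕ) (F : ℤ → ℤ → ℂ)
    (hS : Summable fun h : ℤ × ℤ ↦
      F h.1 h.2 * (dualCount C (a : ZMod C) (b : ZMod C) (h.1 : ZMod C) (h.2 : ZMod C) : ℂ)) :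
    Summable fun h : ℤ × ℤ ↦ (fun k₂ k₁ ↦ F k₁ k₂) h.1 h.2 *
      (dualCount C (b : ZMod C) (a : ZMod C) (h.1 : ZMod C) (h.2 : ZMod C) : ℂ) := by
  refine hS.prod_symm.congr fun h ↦ ?_
  simp only [Prod.fst_swap, Prod.snd_swap]
  rw [dualCount_swap]

/-- **The dual series in `(h₂, s)`-form for a general weight** (`b` a unit mod `C ≥ 2`, `h ↦ F(h)·N_C(a,b;h)` summable):
`Σ_{h∈ℤ²} F(h₁,h₂)·N = Σ'_{h₂} 𝟙[h₂ unit]·Σ'_{s} 𝟙[h₂ ∣ ba + Cs]·F((ba + Cs)/h₂, h₂)`.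
[cite: KowalskiMichelVanderKam2000, Lemma 3.3 p. 9 — derivation] -/
theorem tsum_dual_eq_tsum_switch_weight_right [∀ h₂ : ℤ, Decidable (IsUnit ((h₂ : ℤ) : ZMod C))]
    (hC : 2 ≤ C) (a : ℕ) {b : ℕ} (hb : IsUnit ((b : ℕ) : ZMod C)) (F : ℤ → ℤ → ℂ)
    (hS : Summable fun h : ℤ × ℤ ↦
      F h.1 h.2 * (dualCount C (a : ZMod C) (b : ZMod C) (h.1 : ZMod C) (h.2 : ZMod C) : ℂ)) :
    ∑' h : ℤ × ℤ, F h.1 h.2 * (dualCount C (a : ZMod C) (b : ZMod C) (h.1 : ZMod C) (h.2 : ZMod C) : ℂ) =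
      ∑' h₂ : ℤ, (if IsUnit ((h₂ : ℤ) : ZMod C) then
        ∑' s : ℤ, (if h₂ ∣ (b : ℤ) * a + (C : ℤ) * s then F (((b : ℤ) * a + (C : ℤ) * s) / h₂) h₂ else 0)
        else 0) := by
  rw [tsum_prod_swap]
  simp only [Prod.fst_swap, Prod.snd_swap]
  simp_rw [dual_weight_swap a b F]
  rw [tsum_dual_eq_tsum_switch_weight hC hb a (fun k₂ k₁ ↦ F k₁ k₂) (summable_dual_swap a b F hS)]

/-- **Summability of the outer family in right-switched form** (it is the family of `h₂`-fiber sums). [folklore] -/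
theorem summable_switch_outer_right [∀ h₂ : ℤ, Decidable (IsUnit ((h₂ : ℤ) : ZMod C))] (hC : 2 ≤ C)
    (a : ℕ) {b : ℕ} (hb : IsUnit ((b : ℕ) : ZMod C)) (F : ℤ → ℤ → ℂ)
    (hS : Summable fun h : ℤ × ℤ ↦
      F h.1 h.2 * (dualCount C (a : ZMod C) (b : ZMod C) (h.1 : ZMod C) (h.2 : ZMod C) : ℂ)) :
    Summable fun h₂ : ℤ ↦ (if IsUnit ((h₂ : ℤ) : ZMod C) then
        ∑' s : ℤ, (if h₂ ∣ (b : ℤ) * a + (C : ℤ) * s then F (((b : ℤ) * a + (C : ℤ) * s) / h₂) h₂ else 0)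
        else 0) :=
  summable_switch_outer hC hb a (fun k₂ k₁ ↦ F k₁ k₂) (summable_dual_swap a b F hS)

/-- **The right-switched `s`-family is summable** whenever the `h₁`-fiber `F(·,h₂)·N_C(a,b;·,h₂)` is (for `h₂` a unit).
[folklore] -/
theorem summable_switch_of_summable_fiber_right (hC : 2 ≤ C) (a : ℕ) {b : ℕ} (hb : IsUnit ((b : ℕ) : ZMod C))
    (F : ℤ → ℤ → ℂ) {h₂ : ℤ} (hu : IsUnit ((h₂ : ℤ) : ZMod C))
    (hf : Summable fun h₁ : ℤ ↦
      F h₁ h₂ * (dualCount C (a : ZMod C) (b : ZMod C) (h₁ : ZMod C) (h₂ : ZMod C) : ℂ)) :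
    Summable fun s : ℤ ↦
      (if h₂ ∣ (b : ℤ) * a + (C : ℤ) * s then F (((b : ℤ) * a + (C : ℤ) * s) / h₂) h₂ else 0) := by
  have hf' : Summable fun h₁ : ℤ ↦ (fun k₂ k₁ ↦ F k₁ k₂) h₂ h₁ *
      (dualCount C (b : ZMod C) (a : ZMod C) (h₂ : ZMod C) (h₁ : ZMod C) : ℂ) :=
    hf.congr fun h₁ ↦ dual_weight_swap a b F h₁ h₂
  exact summable_switch_of_summable_fiber hC hb a (fun k₂ k₁ ↦ F k₁ k₂) hu hf'

/-! ### §2. The truncated dual series of `offDiagCore` in `(h₂, s)`-form -/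

/-- The truncated box transform as a weight: its summand identity (the indicator commutes with `N`). [folklore] -/
theorem trunc_summand_eq (a b : ℕ) (Φ : ℝ → ℝ → ℂ) (H : ℕ) (h₁ h₂ : ℤ) :
    (if |h₁| ≤ (H : ℤ) then fourier2 Φ (h₁ / C) (h₂ / C) *
        (dualCount C (a : ZMod C) (b : ZMod C) (h₁ : ZMod C) (h₂ : ZMod C) : ℂ) else 0) =
      (fun k₁ k₂ : ℤ ↦ if |k₁| ≤ (H : ℤ) then fourier2 Φ (k₁ / C) (k₂ / C) else 0) h₁ h₂ *
        (dualCount C (a : ZMod C) (b : ZMod C) (h₁ : ZMod C) (h₂ : ZMod C) : ℂ) := by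
  beta_reduce
  split_ifs <;> simp

/-- The truncated dual family is summable when the dual family is (an indicator sub-family). [folklore] -/
theorem summable_trunc_dual (a b : ℕ) (Φ : ℝ → ℝ → ℂ) (H : ℕ)
    (hS : Summable fun h : ℤ × ℤ ↦ fourier2 Φ (h.1 / C) (h.2 / C) *
      (dualCount C (a : ZMod C) (b : ZMod C) (h.1 : ZMod C) (h.2 : ZMod C) : ℂ)) :
    Summable fun h : ℤ × ℤ ↦
      (fun k₁ k₂ : ℤ ↦ if |k₁| ≤ (H : ℤ) then fourier2 Φ (k₁ / C) (k₂ / C) else 0) h.1 h.2 *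
        (dualCount C (a : ZMod C) (b : ZMod C) (h.1 : ZMod C) (h.2 : ZMod C) : ℂ) := by
  refine (hS.indicator {h : ℤ × ℤ | |h.1| ≤ (H : ℤ)}).congr fun h ↦ ?_
  simp only [Set.indicator_apply, Set.mem_setOf_eq]
  split_ifs <;> simp

/-- The inner `s`-series after the right switch of the truncated weight, in frequency form: under `h₂ ∣ ba + Cs` the
first frequency `((ba + Cs)/h₂)/C` is `s/h₂ + ba/(h₂C)` (`switch_frequency_eq`). [folklore] -/
theorem tsum_inner_trunc_right_eq (a b : ℕ) (Φ : ℝ → ℝ → ℂ) (H : ℕ) {h₂ : ℤ} (hh₂ : h₂ ≠ 0) :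
    ∑' s : ℤ, (if h₂ ∣ (b : ℤ) * a + (C : ℤ) * s then
        (fun k₁ k₂ : ℤ ↦ if |k₁| ≤ (H : ℤ) then fourier2 Φ (k₁ / C) (k₂ / C) else 0)
          (((b : ℤ) * a + (C : ℤ) * s) / h₂) h₂ else 0) =
      ∑' s : ℤ, (if h₂ ∣ (b : ℤ) * a + (C : ℤ) * s then
        (if |((b : ℤ) * a + (C : ℤ) * s) / h₂| ≤ (H : ℤ) then
          fourier2 Φ ((s : ℝ) / h₂ + ((b : ℤ) * a : ℝ) / ((h₂ : ℝ) * C)) (h₂ / C) else 0) else 0) := by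
  refine tsum_congr fun s ↦ ?_
  by_cases hd : h₂ ∣ (b : ℤ) * a + (C : ℤ) * s
  · rw [if_pos hd, if_pos hd]
    beta_reduce
    by_cases ht : |((b : ℤ) * a + (C : ℤ) * s) / h₂| ≤ (H : ℤ)
    · rw [if_pos ht, if_pos ht, switch_frequency_eq hh₂ hd]
      push_cast
      ring_nf
    · rw [if_neg ht, if_neg ht]
  · rw [if_neg hd, if_neg hd]

/-- The same, pointwise (for `Summable.congr`). [folklore] -/
theorem inner_trunc_right_summand_eq (a b : ℕ) (Φ : ℝ → ℝ → ℂ) (H : ℕ) {h₂ : ℤ} (hh₂ : h₂ ≠ 0) (s : ℤ) :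
    (if h₂ ∣ (b : ℤ) * a + (C : ℤ) * s then
        (fun k₁ k₂ : ℤ ↦ if |k₁| ≤ (H : ℤ) then fourier2 Φ (k₁ / C) (k₂ / C) else 0)
          (((b : ℤ) * a + (C : ℤ) * s) / h₂) h₂ else 0) =
      (if h₂ ∣ (b : ℤ) * a + (C : ℤ) * s then
        (if |((b : ℤ) * a + (C : ℤ) * s) / h₂| ≤ (H : ℤ) then
          fourier2 Φ ((s : ℝ) / h₂ + ((b : ℤ) * a : ℝ) / ((h₂ : ℝ) * C)) (h₂ / C) else 0) else 0) := by
  by_cases hd : h₂ ∣ (b : ℤ) * a + (C : ℤ) * s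
  · rw [if_pos hd, if_pos hd]
    beta_reduce
    by_cases ht : |((b : ℤ) * a + (C : ℤ) * s) / h₂| ≤ (H : ℤ)
    · rw [if_pos ht, if_pos ht, switch_frequency_eq hh₂ hd]
      push_cast
      ring_nf
    · rw [if_neg ht, if_neg ht]
  · rw [if_neg hd, if_neg hd]

/-- The outer summand after the right switch of the truncated weight, in frequency form. [folklore] -/
theorem outer_trunc_right_summand_eq [∀ h₂ : ℤ, Decidable (IsUnit ((h₂ : ℤ) : ZMod C))] (hC : 2 ≤ C)
    (a b : ℕ) (Φ : ℝ → ℝ → ℂ) (H : ℕ) (h₂ : ℤ) :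
    (if IsUnit ((h₂ : ℤ) : ZMod C) then
        ∑' s : ℤ, (if h₂ ∣ (b : ℤ) * a + (C : ℤ) * s then
          (fun k₁ k₂ : ℤ ↦ if |k₁| ≤ (H : ℤ) then fourier2 Φ (k₁ / C) (k₂ / C) else 0)
            (((b : ℤ) * a + (C : ℤ) * s) / h₂) h₂ else 0) else 0) =
      (if IsUnit ((h₂ : ℤ) : ZMod C) then
        ∑' s : ℤ, (if h₂ ∣ (b : ℤ) * a + (C : ℤ) * s then
          (if |((b : ℤ) * a + (C : ℤ) * s) / h₂| ≤ (H : ℤ) then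
            fourier2 Φ ((s : ℝ) / h₂ + ((b : ℤ) * a : ℝ) / ((h₂ : ℝ) * C)) (h₂ / C) else 0) else 0)
        else 0) := by
  by_cases hu : IsUnit ((h₂ : ℤ) : ZMod C)
  · rw [if_pos hu, if_pos hu, tsum_inner_trunc_right_eq a b Φ H (intCast_ne_zero_of_isUnit hC hu)]
  · rw [if_neg hu, if_neg hu]

/-- **One `h₂`-fiber of the truncated box series, right-switched** (`b` unit mod `C ≥ 2`):
`Σ'_{h₁} 𝟙[|h₁| ≤ H]·Φ̂(h₁/C,h₂/C)·N_C(a,b;h₁,h₂)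
   = 𝟙[h₂ unit]·Σ'_{s} 𝟙[h₂ ∣ ba + Cs]·𝟙[|(ba + Cs)/h₂| ≤ H]·Φ̂(s/h₂ + ba/(h₂C), h₂/C)`. [folklore] -/
theorem tsum_fiber_trunc_switch_right_fourier2 [∀ h₂ : ℤ, Decidable (IsUnit ((h₂ : ℤ) : ZMod C))] (hC : 2 ≤ C)
    (a : ℕ) {b : ℕ} (hb : IsUnit ((b : ℕ) : ZMod C)) (Φ : ℝ → ℝ → ℂ) (H : ℕ) (h₂ : ℤ) :
    ∑' h₁ : ℤ, (if |h₁| ≤ (H : ℤ) then fourier2 Φ (h₁ / C) (h₂ / C) *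
        (dualCount C (a : ZMod C) (b : ZMod C) (h₁ : ZMod C) (h₂ : ZMod C) : ℂ) else 0) =
      if IsUnit ((h₂ : ℤ) : ZMod C) then
        ∑' s : ℤ, (if h₂ ∣ (b : ℤ) * a + (C : ℤ) * s then
          (if |((b : ℤ) * a + (C : ℤ) * s) / h₂| ≤ (H : ℤ) then
            fourier2 Φ ((s : ℝ) / h₂ + ((b : ℤ) * a : ℝ) / ((h₂ : ℝ) * C)) (h₂ / C) else 0) else 0)
      else 0 := by
  rw [tsum_congr (fun h₁ ↦ trunc_summand_eq a b Φ H h₁ h₂),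
    tsum_fiber_dual_eq_switch_right hC a hb
      (fun k₁ k₂ : ℤ ↦ if |k₁| ≤ (H : ℤ) then fourier2 Φ (k₁ / C) (k₂ / C) else 0) h₂,
    outer_trunc_right_summand_eq hC a b Φ H h₂]

/-- **Truncated dual series of a box weight (the summand of `offDiagCore`), right-switched.** For `C ≥ 2`, `b` a unit
mod `C`, any `a`, any `Φ` whose dual family is summable (box weights: `OffDiag.summable_dual`) and `H : ℕ`:
`Σ_{h∈ℤ²} 𝟙[|h₁| ≤ H]·Φ̂(h₁/C,h₂/C)·N_C(a,b;h)
   = Σ'_{h₂} 𝟙[h₂ unit]·Σ'_{s} 𝟙[h₂ ∣ ba + Cs]·𝟙[|(ba + Cs)/h₂| ≤ H]·Φ̂(s/h₂ + ba/(h₂C), h₂/C)`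
(outer variable a complete series; for each unit `h₂` only finitely many `s` survive the truncation).
[cite: KowalskiMichelVanderKam2000, Lemma 3.3 p. 9 — derivation] -/
theorem tsum_trunc_dual_eq_tsum_switch_right_fourier2 [∀ h₂ : ℤ, Decidable (IsUnit ((h₂ : ℤ) : ZMod C))]
    (hC : 2 ≤ C) (a : ℕ) {b : ℕ} (hb : IsUnit ((b : ℕ) : ZMod C)) (Φ : ℝ → ℝ → ℂ) (H : ℕ)
    (hS : Summable fun h : ℤ × ℤ ↦ fourier2 Φ (h.1 / C) (h.2 / C) *
      (dualCount C (a : ZMod C) (b : ZMod C) (h.1 : ZMod C) (h.2 : ZMod C) : ℂ)) :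
    ∑' h : ℤ × ℤ, (if |h.1| ≤ (H : ℤ) then fourier2 Φ (h.1 / C) (h.2 / C) *
        (dualCount C (a : ZMod C) (b : ZMod C) (h.1 : ZMod C) (h.2 : ZMod C) : ℂ) else 0) =
      ∑' h₂ : ℤ, (if IsUnit ((h₂ : ℤ) : ZMod C) then
        ∑' s : ℤ, (if h₂ ∣ (b : ℤ) * a + (C : ℤ) * s then
          (if |((b : ℤ) * a + (C : ℤ) * s) / h₂| ≤ (H : ℤ) then
            fourier2 Φ ((s : ℝ) / h₂ + ((b : ℤ) * a : ℝ) / ((h₂ : ℝ) * C)) (h₂ / C) else 0) else 0)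
        else 0) := by
  rw [tsum_congr (fun h : ℤ × ℤ ↦ trunc_summand_eq a b Φ H h.1 h.2),
    tsum_dual_eq_tsum_switch_weight_right hC a hb
      (fun k₁ k₂ : ℤ ↦ if |k₁| ≤ (H : ℤ) then fourier2 Φ (k₁ / C) (k₂ / C) else 0) (summable_trunc_dual a b Φ H hS)]
  exact tsum_congr fun h₂ ↦ outer_trunc_right_summand_eq hC a b Φ H h₂

/-- **The outer `h₂`-family of the right-switched truncated series is summable** (it is the family of `h₂`-fiber sums
of the truncated dual family). [folklore] -/
theorem summable_trunc_switch_outer_right_fourier2 [∀ h₂ : ℤ, Decidable (IsUnit ((h₂ : ℤ) : ZMod C))]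
    (hC : 2 ≤ C) (a : ℕ) {b : ℕ} (hb : IsUnit ((b : ℕ) : ZMod C)) (Φ : ℝ → ℝ → ℂ) (H : ℕ)
    (hS : Summable fun h : ℤ × ℤ ↦ fourier2 Φ (h.1 / C) (h.2 / C) *
      (dualCount C (a : ZMod C) (b : ZMod C) (h.1 : ZMod C) (h.2 : ZMod C) : ℂ)) :
    Summable fun h₂ : ℤ ↦ (if IsUnit ((h₂ : ℤ) : ZMod C) then
        ∑' s : ℤ, (if h₂ ∣ (b : ℤ) * a + (C : ℤ) * s then
          (if |((b : ℤ) * a + (C : ℤ) * s) / h₂| ≤ (H : ℤ) then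
            fourier2 Φ ((s : ℝ) / h₂ + ((b : ℤ) * a : ℝ) / ((h₂ : ℝ) * C)) (h₂ / C) else 0) else 0)
        else 0) :=
  (summable_switch_outer_right hC a hb
      (fun k₁ k₂ : ℤ ↦ if |k₁| ≤ (H : ℤ) then fourier2 Φ (k₁ / C) (k₂ / C) else 0) (summable_trunc_dual a b Φ H hS)).congr
    fun h₂ ↦ outer_trunc_right_summand_eq hC a b Φ H h₂

/-- **Each inner `s`-family of the right-switched truncated series is summable** (`h₂` a unit). [folklore] -/
theorem summable_trunc_switch_right_fourier2 (hC : 2 ≤ C) (a : ℕ) {b : ℕ} (hb : IsUnit ((b : ℕ) : ZMod C))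
    (Φ : ℝ → ℝ → ℂ) (H : ℕ) {h₂ : ℤ} (hu : IsUnit ((h₂ : ℤ) : ZMod C))
    (hS : Summable fun h : ℤ × ℤ ↦ fourier2 Φ (h.1 / C) (h.2 / C) *
      (dualCount C (a : ZMod C) (b : ZMod C) (h.1 : ZMod C) (h.2 : ZMod C) : ℂ)) :
    Summable fun s : ℤ ↦ (if h₂ ∣ (b : ℤ) * a + (C : ℤ) * s then
      (if |((b : ℤ) * a + (C : ℤ) * s) / h₂| ≤ (H : ℤ) then
        fourier2 Φ ((s : ℝ) / h₂ + ((b : ℤ) * a : ℝ) / ((h₂ : ℝ) * C)) (h₂ / C) else 0) else 0) := by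
  have hh₂ : h₂ ≠ 0 := intCast_ne_zero_of_isUnit hC hu
  -- the `h₁`-fiber at `h₂` of the truncated family
  have hfib : Summable fun h₁ : ℤ ↦
      (fun k₁ k₂ : ℤ ↦ if |k₁| ≤ (H : ℤ) then fourier2 Φ (k₁ / C) (k₂ / C) else 0) h₁ h₂ *
        (dualCount C (a : ZMod C) (b : ZMod C) (h₁ : ZMod C) (h₂ : ZMod C) : ℂ) :=
    ((hS.prod_symm.prod_factor h₂).indicator {h₁ : ℤ | |h₁| ≤ (H : ℤ)}).congr fun h₁ ↦ by
      simp only [Set.indicator_apply, Set.mem_setOf_eq, Prod.swap_prod_mk]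
      split_ifs <;> simp
  exact (summable_switch_of_summable_fiber_right hC a hb
      (fun k₁ k₂ : ℤ ↦ if |k₁| ≤ (H : ℤ) then fourier2 Φ (k₁ / C) (k₂ / C) else 0) hu hfib).congr
    fun s ↦ inner_trunc_right_summand_eq a b Φ H hh₂ s

/-! ### §3. The block exchange with a series outer variable -/

omit [NeZero C] in
/-- **The block switch with a SERIES outer variable.** For a finite set of levels `G`, a unit predicate `U q h`,
a divisor predicate `D q h s` and weights `g q h s` such that, for every `q ∈ G`, each inner family
`s ↦ 𝟙[D q h s]·g` (under `U q h`) and the outer family `h ↦ 𝟙[U q h]·Σ'_{s} 𝟙[D]·g` are summable: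
`Σ_{q∈G} Σ'_{h} 𝟙[U q h]·Σ'_{s} 𝟙[D q h s]·g = Σ'_{h} Σ'_{s} Σ_{q∈G} 𝟙[U q h]·𝟙[D q h s]·g`. [folklore] -/
theorem sum_levels_tsum_tsum_switch_eq {ι : Type*} (G : Finset ℕ)
    (U : ℕ → ι → Prop) [∀ q h, Decidable (U q h)] (D : ℕ → ι → ℤ → Prop) [∀ q h s, Decidable (D q h s)]
    (g : ℕ → ι → ℤ → ℂ)
    (hsum : ∀ q ∈ G, ∀ h : ι, U q h → Summable fun s : ℤ ↦ if D q h s then g q h s else 0)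
    (hout : ∀ q ∈ G, Summable fun h : ι ↦
      (if U q h then ∑' s : ℤ, (if D q h s then g q h s else 0) else 0)) :
    ∑ q ∈ G, ∑' h : ι, (if U q h then ∑' s : ℤ, (if D q h s then g q h s else 0) else 0) =
      ∑' h : ι, ∑' s : ℤ, ∑ q ∈ G, (if U q h then (if D q h s then g q h s else 0) else 0) := by
  rw [← Summable.tsum_finsetSum hout]
  refine tsum_congr fun h ↦ ?_
  have hin : ∀ q ∈ G, (if U q h then ∑' s : ℤ, (if D q h s then g q h s else 0) else 0) =
      ∑' s : ℤ, (if U q h then (if D q h s then g q h s else 0) else 0) := by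
    intro q _
    by_cases hu : U q h
    · simp only [if_pos hu]
    · simp only [if_neg hu, tsum_zero]
  rw [Finset.sum_congr rfl hin]
  refine (Summable.tsum_finsetSum fun q hq ↦ ?_).symm
  by_cases hu : U q h
  · simp only [if_pos hu]; exact hsum q hq h hu
  · simp only [if_neg hu]; exact summable_zero

end Summit.Parity.GeneralizedHardyLittlewood.Theorems.BeyondDiagonalBeatsQuarter.OffDiag
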